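import Summits.AtomisticToContinuum.Crystallization.Theorems.FrustratedLawDichotomyStrainedPatchHomXiWindow
import Summits.AtomisticToContinuum.Crystallization.Theorems.FrustratedLawDichotomyStrainedPatchHomCoords

/-!
# Aperiodic strained patch — FRAME-LOCAL ξ-WINDOWS («ShearFrames»): the window glue with ONE SHEET PER `U`-FRAME, and the
# `(U, ξ) ↦ (U, ζ := ξ − ξ_c(U))` recentring with its bounded `ζ`-range (cell decomp-a2c-lens-5, g105; critic row 1645 (R4)(2), XIDOM-104 (2))

The ξ-window architecture of record (`…StrainedPatchHomXiWindow`, #38 `…XiWindowQuot`) cuts the hcp half of the homogeneous floor `(H)` on a zone into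
`XiTube Zone σ̂ r` (admissible hcp instances have their shuffle within `r` of ONE global sheet `σ̂`) and the floor on the tube `Zone ∧ ‖ξ − σ̂ G‖ ≤ r`.
The certificate side (hand-1's LOEW leaf `loew_floor_of_lamLoewL`, stated on the BALL `‖ξ − xiCen c aP U‖ ≤ radJ w / SC` around the SHEARED centre
`xiCen c aP U = cenShuf c + A·δU` of ONE `U`-box `(c, w)`) is naturally FRAME-LOCAL: every `U`-box carries its own affine track.  This file shows that the
global sheet is unnecessary and fixes the `ζ`-bookkeeping:

* §1 ★★ FRAME-LOCAL WINDOW GLUE (generic frame index `ι`, frame = (`U`-predicate `Zf f`, track `σf f`, radius `rf f`)): per-frame tube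
  `XiTube (Zone ∧ Zf f) (σf f) (rf f)` ∧ per-frame floor on `(Zone ∧ Zf f) ∧ ‖ξ − σf f G‖ ≤ rf f` ∧ the frames COVER the zone ⟹ `(H∣hcp, Zone)`
  (`homFloorHcp_of_frames`, list form `homFloorHcp_of_frameList`); with the off-zone floor ⟹ the BARE hcp floor `(H∣hcp, ⊤)` (`homFloorHcp_top_of_frames`,
  the currency of #42's consumer `aperiodicFrustratedLawGap_of_semOKF_homFloorHcp_fourSector_transport_A35000_T26_record`) and with the fcc half ⟹ `HomFloor m`
  (`homFloor_of_framePieces`); necessity (`framePiece_of_homFloorHcp`: the cut loses nothing); radius bookkeeping (`framePiece_of_radius_le`: a floor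
  certified on the LEAF ball of radius `R ≥ r` serves the tube of radius `r`; the PIECEWISE-SHEET form of critic row 1647 (E1)/(E5) —
  `σ_PW G := σf (sel G) G` for a selection of one `U`-box per frame: `homFloorHcp_of_piecewiseSheet[_boxes]` («`XiTube Zone σ_PW r → (∀ B, leaf ball
  floor on box B) → (H∣hcp, Zone)`») and `xiTube_piecewiseSheet_of_frames` (the global tube from per-frame tubes) — DESIGN FINDING XIDOM-105: the floor TARGET of a frame is the tube BALL
  `‖ξ − σf f U‖ ≤ r_T` itself, one entry per `U`-frame, served by any leaf ball `radJ/SC ≥ r_T`; an inscribed `ζ`-cube of half-width `r/√3` does NOT contain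
  the tube and is not a valid target); a frame tube from a global one (`xiTube_frame_of_global`, slack `‖σ̂ − σf‖ ≤ s` on the frame).
* §2 ★ RECENTRING `ζ := ξ − x` (`x = σf f U` the track value): `∀ ξ ∈ B(x, r) ↔ ∀ ζ ∈ B(0, r)` (`forall_ball_iff_forall_zeta`), the cube form
  (`forall_cube_iff_forall_zeta`), and the BOUNDED `ζ`-RANGE under the flat confinement `‖ξ‖ ≤ ρ` (`XiConfined`, record `ρ = 1/8`): with the track
  enclosure `|x_i − η_i| ≤ s_i` one has `|ζ_i + η_i| ≤ ρ + s_i` (`abs_zeta_add_le`) and `|ζ_i| ≤ ρ + |η_i| + s_i` (`abs_zeta_le` — critic row 1645 (R4)(2)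
  `|ζ_i| ≤ 1/10 + |η_c,i| + Σ_j |A_ij|·rad_U`), where for an AFFINE track `x = η + A·d`, `|d_e| ≤ wd_e` (hand-1's `xiCen`: `η = cenShuf c`, `A_me = aP m e/SC`,
  `d_e = dU c U e`, `wd_e = w (inl (eIJ e))/SC` by `abs_dU_le`) the enclosure is `s_i = Σ_e |A_ie|·wd_e` (`abs_affineTrack_sub_le`, `abs_zeta_le_affine`).
* §3 ★ BALL ↔ BOX bookkeeping for the leaves: the tube ball sits in its bounding cube (`abs_sub_le_of_norm_sub_le`) and in any box
  `|ξ_i − a_i| ≤ b_i` whose half-widths dominate `r + |x_i − a_i|` (`box_of_ball`, `box_of_ball_zeta`) — the hypothesis shape of the cube leaves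
  `hcpEnergy_of_xiElimL2` (`hξ : ∀ i, |ξ i − c (inr i)/SC| ≤ w (inr i)/SC`); the cube-in-ball direction `norm_sub_sq_le_of_cube` and the explicit
  witness `inscribedCube_misses_tube` (the inscribed `ζ`-cube `h = r/√3` at `r = 3/400` misses the tube point `r·e₀`).

Generic in the track (no `xiCen` import: hand-1's joint kit is lane-HELD; instantiation `σf f := xiCen (c f) (aP f)` is by `rfl`).  Def-free; one-line to ten-line
proofs over TREE files `…HomXiWindow` + `…HomCoords`; 0 sorry; standard axioms.  `--supports stmt-AtomisticToContinuum-27623 --as helper`.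
[folklore instantiation / formal bookkeeping]
-/

namespace Summit.AtomisticToContinuum.Crystallization.Theorems.FrustratedLawDichotomyStrainedPatchHomShearFrames

open scoped BigOperators
open Summit.AtomisticToContinuum.Crystallization.Theorems.ChargedEnergyGapNegative (E3)
open Summit.AtomisticToContinuum.Crystallization.Theorems.FrustratedLawDichotomyStrainedPatchHomSplit
open Summit.AtomisticToContinuum.Crystallization.Theorems.FrustratedLawDichotomyStrainedPatchHomXiWindow
open Summit.AtomisticToContinuum.Crystallization.Theorems.FrustratedLawDichotomyStrainedPatchHomCoords (coord_mem_cube_of_norm_le)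

/-! ## §1. Frame-local window glue -/

section Frames

variable {ι : Type*}

/-- ★★ **FRAME-LOCAL WINDOW GLUE.** Frames `f : ι` = (`U`-predicate `Zf f`, track `σf f`, tube radius `rf f`).  If on every frame the admissible hcp
instances of the zone have their shuffle in the frame's tube, the floor holds on every frame tube, and every `(G, ξ)` of the zone (with `‖G − 1‖ ≤ 1/4`,
`‖ξ‖ ≤ 1/4`) lies on some frame, then the floor holds on the zone.  No global sheet. [three lines over `homFloorHcp_of_xiTube`] -/
theorem homFloorHcp_of_frames (Zone : (E3 →L[ℝ] E3) → E3 → Prop) (Zf : ι → (E3 →L[ℝ] E3) → Prop) (σf : ι → (E3 →L[ℝ] E3) → E3) (rf : ι → ℝ)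
    {m : ℝ} (hT : ∀ f, XiTube (fun G ξ => Zone G ξ ∧ Zf f G) (σf f) (rf f))
    (hE : ∀ f, HomFloorHcp (fun G ξ => (Zone G ξ ∧ Zf f G) ∧ ‖ξ - σf f G‖ ≤ rf f) m)
    (hcov : ∀ (G : E3 →L[ℝ] E3) (ξ : E3), ‖G - 1‖ ≤ 1 / 4 → ‖ξ‖ ≤ 1 / 4 → Zone G ξ → ∃ f, Zf f G) : HomFloorHcp Zone m := by
  rintro M z c hz ⟨G, ξ, hG, hξ, hZ, hr⟩
  obtain ⟨f, hf⟩ := hcov G ξ hG hξ hZ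
  exact homFloorHcp_of_xiTube (hT f) (hE f) M z c hz ⟨G, ξ, hG, hξ, ⟨hZ, hf⟩, hr⟩

/-- ★ LIST FORM (a finite frame book `L`). [formal bookkeeping] -/
theorem homFloorHcp_of_frameList (L : List ι) (Zone : (E3 →L[ℝ] E3) → E3 → Prop) (Zf : ι → (E3 →L[ℝ] E3) → Prop)
    (σf : ι → (E3 →L[ℝ] E3) → E3) (rf : ι → ℝ) {m : ℝ} (hT : ∀ f ∈ L, XiTube (fun G ξ => Zone G ξ ∧ Zf f G) (σf f) (rf f))
    (hE : ∀ f ∈ L, HomFloorHcp (fun G ξ => (Zone G ξ ∧ Zf f G) ∧ ‖ξ - σf f G‖ ≤ rf f) m)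
    (hcov : ∀ (G : E3 →L[ℝ] E3) (ξ : E3), ‖G - 1‖ ≤ 1 / 4 → ‖ξ‖ ≤ 1 / 4 → Zone G ξ → ∃ f ∈ L, Zf f G) : HomFloorHcp Zone m :=
  homFloorHcp_of_frames (ι := {f // f ∈ L}) Zone (fun f => Zf f.1) (fun f => σf f.1) (fun f => rf f.1) (fun f => hT f.1 f.2) (fun f => hE f.1 f.2)
    fun G ξ hG hξ hZ => by
      obtain ⟨f, hf, h⟩ := hcov G ξ hG hξ hZ
      exact ⟨⟨f, hf⟩, h⟩

/-- ★★ **THE BARE hcp FLOOR FROM FRAMES** (zone keyed by the frame `G` only, as in #38): frames covering `Zone` ∧ the off-zone floor ⟹ `(H∣hcp, ⊤)` — the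
currency of #42 `aperiodicFrustratedLawGap_of_semOKF_homFloorHcp_fourSector_transport_A35000_T26_record`. [`homFloorHcp_split` at `⊤`/`Zone`] -/
theorem homFloorHcp_top_of_frames (Zone : (E3 →L[ℝ] E3) → Prop) (Zf : ι → (E3 →L[ℝ] E3) → Prop) (σf : ι → (E3 →L[ℝ] E3) → E3) (rf : ι → ℝ)
    {m : ℝ} (hT : ∀ f, XiTube (fun G _ => Zone G ∧ Zf f G) (σf f) (rf f))
    (hE : ∀ f, HomFloorHcp (fun G ξ => (Zone G ∧ Zf f G) ∧ ‖ξ - σf f G‖ ≤ rf f) m)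
    (hcov : ∀ G : E3 →L[ℝ] E3, ‖G - 1‖ ≤ 1 / 4 → Zone G → ∃ f, Zf f G) (hU : HomFloorHcp (fun G _ => ¬Zone G) m) :
    HomFloorHcp (fun _ _ => True) m := by
  refine (homFloorHcp_split (fun _ _ => True) (fun G _ => Zone G)).mpr ⟨?_, ?_⟩
  · exact (homFloorHcp_of_frames (fun G _ => Zone G) Zf σf rf hT hE fun G _ hG _ hZ => hcov G hG hZ).mono_zone fun _ _ h => h.2
  · exact hU.mono_zone fun _ _ h => h.2

/-- ★★ **ASSEMBLY OF `(H)` FROM FRAME PIECES**: fcc half ∧ per-frame tubes ∧ per-frame floors ∧ cover ∧ off-zone hcp floor ⟹ `HomFloor m`.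
[`homFloor_iff_fcc_and_hcp`] -/
theorem homFloor_of_framePieces (Zone : (E3 →L[ℝ] E3) → Prop) (Zf : ι → (E3 →L[ℝ] E3) → Prop) (σf : ι → (E3 →L[ℝ] E3) → E3) (rf : ι → ℝ)
    {m : ℝ} (hF : HomFloorFcc (fun _ => True) m) (hT : ∀ f, XiTube (fun G _ => Zone G ∧ Zf f G) (σf f) (rf f))
    (hE : ∀ f, HomFloorHcp (fun G ξ => (Zone G ∧ Zf f G) ∧ ‖ξ - σf f G‖ ≤ rf f) m)
    (hcov : ∀ G : E3 →L[ℝ] E3, ‖G - 1‖ ≤ 1 / 4 → Zone G → ∃ f, Zf f G) (hU : HomFloorHcp (fun G _ => ¬Zone G) m) : HomFloor m :=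
  homFloor_iff_fcc_and_hcp.mpr ⟨hF, homFloorHcp_top_of_frames Zone Zf σf rf hT hE hcov hU⟩

/-- NECESSITY: every frame piece follows from the zone floor (the frame cut loses nothing; only the tubes are extra knowledge). [`mono_zone`] -/
theorem framePiece_of_homFloorHcp {Zone : (E3 →L[ℝ] E3) → E3 → Prop} {m : ℝ} (h : HomFloorHcp Zone m) (Zf : ι → (E3 →L[ℝ] E3) → Prop)
    (σf : ι → (E3 →L[ℝ] E3) → E3) (rf : ι → ℝ) (f : ι) : HomFloorHcp (fun G ξ => (Zone G ξ ∧ Zf f G) ∧ ‖ξ - σf f G‖ ≤ rf f) m :=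
  h.mono_zone fun _ _ hG => hG.1.1

/-- ★ RADIUS BOOKKEEPING (XIDOM-105): a floor certified on the LEAF ball of radius `R` around the track serves the TUBE of any radius `r ≤ R` — the frame's
floor target is the tube ball itself, served by any leaf ball containing it. [`mono_zone`] -/
theorem framePiece_of_radius_le {Zh : (E3 →L[ℝ] E3) → E3 → Prop} {σ : (E3 →L[ℝ] E3) → E3} {r R m : ℝ} (hle : r ≤ R)
    (h : HomFloorHcp (fun G ξ => Zh G ξ ∧ ‖ξ - σ G‖ ≤ R) m) : HomFloorHcp (fun G ξ => Zh G ξ ∧ ‖ξ - σ G‖ ≤ r) m :=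
  h.mono_zone fun _ _ hG => ⟨hG.1, hG.2.trans hle⟩

/-- The per-frame floor obligation restricted from a floor on the whole frame slab `Zone ∧ Zf f` (e.g. a flat-window certificate). [`mono_zone`] -/
theorem framePiece_of_slab {Zone : (E3 →L[ℝ] E3) → E3 → Prop} {Zf : (E3 →L[ℝ] E3) → Prop} {m : ℝ}
    (h : HomFloorHcp (fun G ξ => Zone G ξ ∧ Zf G) m) (σ : (E3 →L[ℝ] E3) → E3) (r : ℝ) :
    HomFloorHcp (fun G ξ => (Zone G ξ ∧ Zf G) ∧ ‖ξ - σ G‖ ≤ r) m :=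
  h.mono_zone fun _ _ hG => hG.1

/-- ★ A FRAME TUBE FROM A GLOBAL ONE: if the global sheet `σ̂` is within `s` of the frame track on the frame, the global tube of radius `r` gives the frame tube
of radius `r + s`. [triangle inequality] -/
theorem xiTube_frame_of_global {Zone : (E3 →L[ℝ] E3) → E3 → Prop} {σh : (E3 →L[ℝ] E3) → E3} {r : ℝ} (hT : XiTube Zone σh r)
    (Zf : (E3 →L[ℝ] E3) → Prop) {σ : (E3 →L[ℝ] E3) → E3} {s : ℝ} (hs : ∀ G, ‖G - 1‖ ≤ 1 / 4 → Zf G → ‖σh G - σ G‖ ≤ s) :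
    XiTube (fun G ξ => Zone G ξ ∧ Zf G) σ (r + s) := by
  intro M z c G ξ hz hG hξ hZ hr
  calc ‖ξ - σ G‖ = ‖(ξ - σh G) + (σh G - σ G)‖ := by rw [sub_add_sub_cancel]
    _ ≤ ‖ξ - σh G‖ + ‖σh G - σ G‖ := norm_add_le _ _
    _ ≤ r + s := add_le_add (hT M z c G ξ hz hG hξ hZ.1 hr) (hs G hG hZ.2)

/-- Conversely a frame tube is a global tube on the frame slab for the sheet `σf f` (so a ONE-frame book is the global architecture). [definitional] -/
theorem xiTube_slab_iff {Zone : (E3 →L[ℝ] E3) → E3 → Prop} (Zf : (E3 →L[ℝ] E3) → Prop) (σ : (E3 →L[ℝ] E3) → E3) (r : ℝ) :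
    XiTube (fun G ξ => Zone G ξ ∧ Zf G) σ r ↔
      ∀ (M : ℕ) (z : Fin M → E3) (c : Fin M) (G : E3 →L[ℝ] E3) (ξ : E3), Admissible M z c → ‖G - 1‖ ≤ 1 / 4 → ‖ξ‖ ≤ 1 / 4 → Zone G ξ → Zf G →
        Set.range z = hcpSet G ξ (z c) (133 / 10) → ‖ξ - σ G‖ ≤ r :=
  ⟨fun h M z c G ξ hz hG hξ hZ hf hr => h M z c G ξ hz hG hξ ⟨hZ, hf⟩ hr, fun h M z c G ξ hz hG hξ hZ hr => h M z c G ξ hz hG hξ hZ.1 hZ.2 hr⟩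

/-- ★★ **PIECEWISE SHEET = FRAMES** (critic row 1647 (E1)/(E5) shape): for a SELECTION `sel` of one frame per `G` and frame tracks `σf`, let the
piecewise sheet be `σ_PW G := σf (sel G) G`.  Then ONE global tube `XiTube Zone σ_PW r` and the per-frame floors on the selection fibres
`(Zone ∧ sel G = B) ∧ ‖ξ − σf B G‖ ≤ r` give the zone floor — the fibre tube is the global tube verbatim (`xiTube_frame_of_global` at slack `0`).
[formal bookkeeping] -/
theorem homFloorHcp_of_piecewiseSheet (Zone : (E3 →L[ℝ] E3) → E3 → Prop) (sel : (E3 →L[ℝ] E3) → ι) (σf : ι → (E3 →L[ℝ] E3) → E3) (r : ℝ)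
    {m : ℝ} (hT : XiTube Zone (fun G => σf (sel G) G) r)
    (hE : ∀ B, HomFloorHcp (fun G ξ => (Zone G ξ ∧ sel G = B) ∧ ‖ξ - σf B G‖ ≤ r) m) : HomFloorHcp Zone m :=
  homFloorHcp_of_frames Zone (fun B G => sel G = B) σf (fun _ => r)
    (fun B => by
      have h := xiTube_frame_of_global hT (fun G => sel G = B) (σ := σf B) (s := 0) fun G _ hB => by subst hB; simp
      simpa using h)
    hE fun G _ _ _ _ => ⟨sel G, rfl⟩

/-- ★★ **… OVER A `U`-BOX TABLE** (the (E5) cover «`XiTube Zone σ_PW r → (∀ B, leaf ball floor on box B) → (H∣hcp, Zone)`»): if the selection picks a box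
containing `G` (`hsel`), the per-BOX ball floors `(Zone ∧ box B) ∧ ‖ξ − σf B G‖ ≤ r` (one LOEW entry per `U`-frame, hand-1's `loew_box_floor` at
`σf B := xiCen (c B) (aP B)`, `r := radJ/SC`) restrict to the fibres. [`mono_zone`] -/
theorem homFloorHcp_of_piecewiseSheet_boxes (Zone : (E3 →L[ℝ] E3) → E3 → Prop) (box : ι → (E3 →L[ℝ] E3) → Prop) (sel : (E3 →L[ℝ] E3) → ι)
    (hsel : ∀ G, ‖G - 1‖ ≤ 1 / 4 → box (sel G) G) (σf : ι → (E3 →L[ℝ] E3) → E3) (r : ℝ) {m : ℝ} (hT : XiTube Zone (fun G => σf (sel G) G) r)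
    (hE : ∀ B, HomFloorHcp (fun G ξ => (Zone G ξ ∧ box B G) ∧ ‖ξ - σf B G‖ ≤ r) m) : HomFloorHcp Zone m := by
  refine homFloorHcp_of_frames Zone (fun B G => sel G = B) σf (fun _ => r) (fun B => ?_) (fun B => ?_) fun G _ _ _ _ => ⟨sel G, rfl⟩
  · have h := xiTube_frame_of_global hT (fun G => sel G = B) (σ := σf B) (s := 0) fun G _ hB => by subst hB; simp
    simpa using h
  · rintro M z c hz ⟨G, ξ, hG, hξ, ⟨⟨hZ, hB⟩, hr⟩, hrange⟩
    exact hE B M z c hz ⟨G, ξ, hG, hξ, ⟨⟨hZ, hB ▸ hsel G hG⟩, hr⟩, hrange⟩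

/-- The tube of the piecewise sheet from PER-FRAME tubes on the fibres (so the XI instrument may be certified frame by frame, relative to each frame's own
affine track, as (E5) rules). [definitional] -/
theorem xiTube_piecewiseSheet_of_frames (Zone : (E3 →L[ℝ] E3) → E3 → Prop) (sel : (E3 →L[ℝ] E3) → ι) (σf : ι → (E3 →L[ℝ] E3) → E3) (r : ℝ)
    (hT : ∀ B, XiTube (fun G ξ => Zone G ξ ∧ sel G = B) (σf B) r) : XiTube Zone (fun G => σf (sel G) G) r :=
  fun M z c G ξ hz hG hξ hZ hr => hT (sel G) M z c G ξ hz hG hξ ⟨hZ, rfl⟩ hr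

end Frames

/-! ## §2. Recentring `ζ := ξ − x` at the track value and the bounded `ζ`-range -/

section Zeta

/-- ★ **`(U, ξ) ↦ (U, ζ)` ON THE TUBE BALL**: quantifying over the shuffles of the tube `B(x, r)` is quantifying over `ζ ∈ B(0, r)` at `ξ = x + ζ`
(`x = σf f U` the frame track). [`add_sub_cancel`] -/
theorem forall_ball_iff_forall_zeta (P : E3 → Prop) (x : E3) (r : ℝ) :
    (∀ ξ : E3, ‖ξ - x‖ ≤ r → P ξ) ↔ ∀ ζ : E3, ‖ζ‖ ≤ r → P (x + ζ) := by
  constructor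
  · intro h ζ hζ
    exact h (x + ζ) (by simpa using hζ)
  · intro h ξ hξ
    simpa using h (ξ - x) hξ

/-- ★ CUBE FORM: the box `|ξ_i − x_i − t_i| ≤ h_i` around the track is the `ζ`-box `|ζ_i − t_i| ≤ h_i`. [`add_sub_cancel`] -/
theorem forall_cube_iff_forall_zeta (P : E3 → Prop) (x : E3) (t h : Fin 3 → ℝ) :
    (∀ ξ : E3, (∀ i, |ξ i - x i - t i| ≤ h i) → P ξ) ↔ ∀ ζ : E3, (∀ i, |ζ i - t i| ≤ h i) → P (x + ζ) := by
  constructor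
  · intro hP ζ hζ
    refine hP (x + ζ) fun i => ?_
    simpa [PiLp.add_apply, add_sub_cancel_left] using hζ i
  · intro hP ξ hξ
    have := hP (ξ - x) fun i => by simpa [PiLp.sub_apply] using hξ i
    simpa using this

/-- Coordinates are bounded by the norm: `‖ξ‖ ≤ ρ ⟹ |ξ_i| ≤ ρ`. [`coord_mem_cube_of_norm_le`] -/
theorem abs_apply_le_of_norm_le {ξ : E3} {ρ : ℝ} (hξ : ‖ξ‖ ≤ ρ) (i : Fin 3) : |ξ i| ≤ ρ :=
  abs_le.2 (coord_mem_cube_of_norm_le hξ i)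

/-- ★ **BOUNDED `ζ`-RANGE, centred form**: under the flat confinement `‖ξ‖ ≤ ρ` and the track enclosure `|x_i − η_i| ≤ s_i`, `ζ = ξ − x` satisfies
`|ζ_i + η_i| ≤ ρ + s_i` (the `ζ`-domain of a frame is the box centre `−η`, half-widths `ρ + s_i`). [triangle inequality] -/
theorem abs_zeta_add_le {ξ x : E3} {ρ : ℝ} (hξ : ‖ξ‖ ≤ ρ) {η s : Fin 3 → ℝ} (hx : ∀ i, |x i - η i| ≤ s i) (i : Fin 3) :
    |(ξ - x) i + η i| ≤ ρ + s i := by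
  have h1 := abs_apply_le_of_norm_le hξ i
  have h2 := hx i
  rw [PiLp.sub_apply]
  calc |ξ i - x i + η i| = |ξ i - (x i - η i)| := by ring_nf
    _ ≤ |ξ i| + |x i - η i| := abs_sub _ _
    _ ≤ ρ + s i := add_le_add h1 h2

/-- ★ **BOUNDED `ζ`-RANGE** (critic row 1645 (R4)(2): `|ζ_i| ≤ ρ + |η_c,i| + Σ_j |A_ij|·rad_U`): `|ζ_i| ≤ ρ + |η_i| + s_i`. [triangle inequality] -/
theorem abs_zeta_le {ξ x : E3} {ρ : ℝ} (hξ : ‖ξ‖ ≤ ρ) {η s : Fin 3 → ℝ} (hx : ∀ i, |x i - η i| ≤ s i) (i : Fin 3) :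
    |(ξ - x) i| ≤ ρ + |η i| + s i := by
  have h1 := abs_apply_le_of_norm_le hξ i
  have h2 := hx i
  rw [PiLp.sub_apply]
  calc |ξ i - x i| = |ξ i - (x i - η i) - η i| := by ring_nf
    _ ≤ |ξ i - (x i - η i)| + |η i| := abs_sub _ _
    _ ≤ |ξ i| + |x i - η i| + |η i| := by gcongr; exact abs_sub _ _
    _ ≤ ρ + |η i| + s i := by linarith

/-- Norm form of the range: `‖ζ‖ ≤ ρ + ‖x‖`. [`norm_sub_le`] -/
theorem norm_zeta_le {ξ x : E3} {ρ : ℝ} (hξ : ‖ξ‖ ≤ ρ) : ‖ξ - x‖ ≤ ρ + ‖x‖ :=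
  (norm_sub_le ξ x).trans (by linarith)

/-- ★ **AFFINE TRACK ENCLOSURE**: for `x` with `x_m − η_m = Σ_e A_me·d_e` and `|d_e| ≤ wd_e` (hand-1's sheared centre `xiCen c aP U = cenShuf c + A·δU`,
`A_me = aP m e/SC`, `d_e = dU c U e`, `wd_e = w (inl (eIJ e))/SC` by `abs_dU_le`): `|x_m − η_m| ≤ Σ_e |A_me|·wd_e`. [`Finset.abs_sum_le_sum_abs`] -/
theorem abs_affineTrack_sub_le {k : ℕ} {x : E3} {η : Fin 3 → ℝ} {A : Fin 3 → Fin k → ℝ} {d wd : Fin k → ℝ}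
    (hx : ∀ m, x m - η m = ∑ e, A m e * d e) (hd : ∀ e, |d e| ≤ wd e) (m : Fin 3) : |x m - η m| ≤ ∑ e, |A m e| * wd e := by
  rw [hx m]
  refine (Finset.abs_sum_le_sum_abs _ _).trans (Finset.sum_le_sum fun e _ => ?_)
  rw [abs_mul]
  exact mul_le_mul_of_nonneg_left (hd e) (abs_nonneg _)

/-- The literal `EuclideanSpace.equiv` presentation of an affine track (the shape of `xiCen`) has the components `x_m − η_m = Σ_e A_me·d_e`.
[formal bookkeeping] -/
theorem affineTrack_sub_apply {k : ℕ} (η : E3) (A : Fin 3 → Fin k → ℝ) (d : Fin k → ℝ) (m : Fin 3) :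
    (η + (EuclideanSpace.equiv (Fin 3) ℝ).symm (fun m => ∑ e, A m e * d e)) m - η m = ∑ e, A m e * d e := by
  simp [PiLp.add_apply]

/-- ★ THE `ζ`-RANGE OF AN AFFINE-TRACK FRAME: `‖ξ‖ ≤ ρ`, `x = η + A·d`, `|d_e| ≤ wd_e` ⟹ `|ζ_m| ≤ ρ + |η_m| + Σ_e |A_me|·wd_e` and
`|ζ_m + η_m| ≤ ρ + Σ_e |A_me|·wd_e`. [composition] -/
theorem abs_zeta_le_affine {k : ℕ} {ξ x : E3} {ρ : ℝ} (hξ : ‖ξ‖ ≤ ρ) {η : Fin 3 → ℝ} {A : Fin 3 → Fin k → ℝ} {d wd : Fin k → ℝ}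
    (hx : ∀ m, x m - η m = ∑ e, A m e * d e) (hd : ∀ e, |d e| ≤ wd e) (m : Fin 3) :
    |(ξ - x) m| ≤ ρ + |η m| + ∑ e, |A m e| * wd e ∧ |(ξ - x) m + η m| ≤ ρ + ∑ e, |A m e| * wd e :=
  ⟨abs_zeta_le hξ (abs_affineTrack_sub_le hx hd) m, abs_zeta_add_le hξ (abs_affineTrack_sub_le hx hd) m⟩

end Zeta

/-! ## §3. Ball ↔ box bookkeeping for the leaves -/

section BallBox

/-- The tube ball lies in its bounding cube: `‖ξ − x‖ ≤ r ⟹ |ξ_i − x_i| ≤ r`. [`coord_mem_cube_of_norm_le`] -/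
theorem abs_sub_le_of_norm_sub_le {ξ x : E3} {r : ℝ} (h : ‖ξ - x‖ ≤ r) (i : Fin 3) : |ξ i - x i| ≤ r := by
  have := abs_apply_le_of_norm_le h i
  rwa [PiLp.sub_apply] at this

/-- ★ **TUBE BALL ⊆ BOX**: if the box `|ξ_i − a_i| ≤ b_i` has half-widths dominating `r + |x_i − a_i|`, it contains the tube ball `B(x, r)` — at
`a_i = cz_i/SC`, `b_i = wz_i/SC` this is the hypothesis shape `hξ : ∀ i, |ξ i − c (inr i)/SC| ≤ w (inr i)/SC` of the cube leaves (`hcpEnergy_of_xiElimL2`),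
so a cube leaf whose box passes this check serves the frame's tube. [triangle inequality] -/
theorem box_of_ball {ξ x : E3} {r : ℝ} (h : ‖ξ - x‖ ≤ r) {a b : Fin 3 → ℝ} (hc : ∀ i, r + |x i - a i| ≤ b i) (i : Fin 3) :
    |ξ i - a i| ≤ b i := by
  have h1 := abs_sub_le_of_norm_sub_le h i
  calc |ξ i - a i| = |(ξ i - x i) + (x i - a i)| := by ring_nf
    _ ≤ |ξ i - x i| + |x i - a i| := abs_add_le _ _
    _ ≤ r + |x i - a i| := by linarith
    _ ≤ b i := hc i

/-- The same with the `ζ`-presentation of the leaf box: `‖ζ‖ ≤ r` and `r + |a_i| ≤ b_i` ⟹ `|ζ_i − a_i| ≤ b_i` (a `ζ`-box around `0` containing the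
tube ball). [triangle inequality] -/
theorem box_of_ball_zeta {ζ : E3} {r : ℝ} (h : ‖ζ‖ ≤ r) {a b : Fin 3 → ℝ} (hc : ∀ i, r + |a i| ≤ b i) (i : Fin 3) : |ζ i - a i| ≤ b i := by
  have h1 := abs_apply_le_of_norm_le h i
  calc |ζ i - a i| ≤ |ζ i| + |a i| := abs_sub _ _
    _ ≤ r + |a i| := by linarith
    _ ≤ b i := hc i

/-- Conversely a box of half-widths `h_i` around `x` lies in the ball of radius `√3 · max h` — recorded in the squared form
`‖ξ − x‖² ≤ Σ_i h_i²` (so a `ζ`-cube of half-width `h` is inside the tube ball iff `3h² ≤ r²`; at `h = r/√3` it is INSCRIBED, not circumscribed —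
`inscribedCube_misses_tube` below).
[`EuclideanSpace.norm_sq_eq`] -/
theorem norm_sub_sq_le_of_cube {ξ x : E3} {h : Fin 3 → ℝ} (hb : ∀ i, |ξ i - x i| ≤ h i) : ‖ξ - x‖ ^ 2 ≤ ∑ i, h i ^ 2 := by
  rw [EuclideanSpace.norm_sq_eq]
  refine Finset.sum_le_sum fun i _ => ?_
  rw [Real.norm_eq_abs, PiLp.sub_apply, sq_abs]
  have := hb i
  exact sq_le_sq' (by linarith [abs_le.1 this |>.1]) (abs_le.1 this).2

/-- ★ **XIDOM-105 WITNESS**: at the record tube radius `r = 3/400` the INSCRIBED `ζ`-cube of half-width `r/√3` misses tube points — `ζ = r·e₀` lies in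
the tube ball and outside the cube; hence a frame's floor TARGET is the tube ball (served by a leaf ball `radJ/SC ≥ r`, or by a box passing `box_of_ball`),
never the inscribed cube. [explicit witness] -/
theorem inscribedCube_misses_tube : ∃ ζ : E3, ‖ζ‖ ≤ 3 / 400 ∧ ¬ (∀ i : Fin 3, |ζ i| ≤ 3 / 400 / Real.sqrt 3) := by
  refine ⟨EuclideanSpace.single 0 (3 / 400 : ℝ), ?_, ?_⟩
  · simp
  · intro h
    have h0 := h 0
    simp only [PiLp.single_apply, if_true] at h0
    have hs : (1 : ℝ) < Real.sqrt 3 := by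
      rw [show (1 : ℝ) = Real.sqrt 1 by simp]
      exact Real.sqrt_lt_sqrt (by norm_num) (by norm_num)
    have hpos : (0 : ℝ) < Real.sqrt 3 := by positivity
    have : (3 : ℝ) / 400 / Real.sqrt 3 < 3 / 400 := by
      rw [div_lt_iff₀ hpos]; nlinarith
    have h0' : |(3 : ℝ) / 400| ≤ 3 / 400 / Real.sqrt 3 := h0
    rw [abs_of_pos (by norm_num : (0:ℝ) < 3/400)] at h0'
    linarith

end BallBox

end Summit.AtomisticToContinuum.Crystallization.Theorems.FrustratedLawDichotomyStrainedPatchHomShearFrames
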